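import Mathlib.Analysis.SpecialFunctions.Log.NegMulLog
import Mathlib.Data.Fin.Tuple.Sort
import Mathlib.Data.List.GetD
import Literature.Computability.AlgebraicComplexity.WeightedEntropyMax
import Literature.Computability.AlgebraicComplexity.QuantumFunctionalsUpper
import HarnessLib

/-!
# Schur-concavity of the Shannon entropy under majorisation by a partition, and subadditivity

Topic: `Literature/Computability/AlgebraicComplexity`; entropy tool-kit for the proof of
Christandl–Vrana–Zuiddam, Lemma 3.11 / Lemma 3.13 (sub-additivity and sub-multiplicativity of the
upper quantum functional, named facts `ChristandlVranaZuiddam2023_upper_subadditive` /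
`_upper_submultiplicative` of `QuantumFunctionalsUpper.lean`) by the *majorisation property*
(CVZ Remark 3.33: `P_λ v_i ≠ 0 ⇒ type(i) ⊴ λ`, "in particular … `H(Q) ≥ H(λ̄)`, since the Shannon
entropy is Schur-concave"). Two elementary facts about the Shannon entropy are proved here, in
nats (`∑ negMulLog`) and in the bit-normalised forms used by `partitionEntropy` / `shannonEntropy`:

* `sum_negMulLog_parts_le_of_dominated` — **Schur-concavity under majorisation by a partition**:
  if a content function `c : α → ℕ` with `∑ c = n` is *dominated* by `λ ⊢ n` in the subset-sum
  sense `∑_{a ∈ S} c a ≤ λ₁ + ⋯ + λ_{|S|}` for every finite set `S` of letters (equivalently: the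
  decreasing rearrangement of `c` is `⊴ λ` in the dominance order), then
  `∑_i -λ̄_i log λ̄_i ≤ ∑_a -(c_a/n) log (c_a/n)`, i.e. `H(λ̄) ≤ H(c/n)`
  (`partitionEntropy_le_of_dominated`). Proof: the classical transfer ("Robin Hood") induction
  — sort `c`; if `λ ≠ c` move one box of `λ` from the first row where `λ` exceeds `c` to the first
  later row where it falls short; this keeps `λ ⊵ c`, decreases `∑ λ_i²`, and does not decrease
  `∑ g(λ_i)` for any `g` with `g a + g b ≤ g (a-1) + g (b+1)` (`b < a`), which holds for
  `g m = -(m/n) log (m/n)` by concavity of `negMulLog` (`negMulLog_transfer_le`).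
* `shannonEntropy_le_shannonEntropy_fst_add_snd` — **subadditivity** `H(P) ≤ H(P₁) + H(P₂)` for a
  probability vector on `α × β` and its two marginals (Gibbs' inequality against `P₁ ⊗ P₂`, the
  tree's `shannonEntropy_le_sum_mul_neg_logb`), with the content form
  `sum_negMulLog_div_le_rows_add_cols`.

References: A. W. Marshall, I. Olkin, B. C. Arnold, *Inequalities: Theory of Majorization and its
Applications*, 2nd ed. (Springer 2011), Ch. 1 §A.3 (Muirhead/Hardy–Littlewood–Pólya: `x ≺ y` iff
`x` is reached from `y` by finitely many transfers), Ch. 3 Prop. C.1 (sums of concave functions are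
Schur-concave), Ch. 5 §A (integer majorisation, Lemma D.1); T. M. Cover, J. A. Thomas, *Elements of
Information Theory*, 2nd ed., Thm. 2.6.6 (subadditivity / independence bound). All [folklore].
No new definitions.
-/

noncomputable section

open scoped BigOperators
open Real (negMulLog)

namespace Literature.Computability.AlgebraicComplexity

/-! ## Transfers and discrete concavity -/

section Transfer

/-- **Discrete concavity of `m ↦ -(m/n) log (m/n)`**: moving one unit from a larger natural number
`a` to a smaller one `b` does not decrease `g a + g b`, `g m = negMulLog (m / n)` (two applications
of the concavity of `negMulLog` on `[0, ∞)`). [folklore] -/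
theorem negMulLog_transfer_le (n : ℕ) {a b : ℕ} (hba : b < a) :
    negMulLog ((a : ℝ) / n) + negMulLog ((b : ℝ) / n) ≤
      negMulLog (((a - 1 : ℕ) : ℝ) / n) + negMulLog (((b + 1 : ℕ) : ℝ) / n) := by
  rcases Nat.eq_zero_or_pos n with hn | hn
  · subst hn
    simp
  have ha1 : 1 ≤ a := by omega
  -- the points `x = b/n < z = a/n` and the weights `t = (a-b-1)/(a-b)`, `1 - t = 1/(a-b)`
  set x : ℝ := (b : ℝ) / n with hx
  set z : ℝ := (a : ℝ) / n with hz
  have hab : (0 : ℝ) < (a : ℝ) - b := by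
    have : (b : ℝ) < a := by exact_mod_cast hba
    linarith
  set t : ℝ := ((a : ℝ) - b - 1) / ((a : ℝ) - b) with ht
  have ht0 : 0 ≤ t := by
    rw [ht]
    refine div_nonneg ?_ hab.le
    have : (b : ℝ) + 1 ≤ a := by exact_mod_cast hba
    linarith
  have ht1 : t ≤ 1 := by
    rw [ht, div_le_one hab]
    linarith
  have hx0 : 0 ≤ x := by positivity
  have hz0 : 0 ≤ z := by positivity
  have hn' : (n : ℝ) ≠ 0 := by exact_mod_cast hn.ne'
  -- `b + 1 = t b + (1 - t) a` and `a - 1 = (1 - t) b + t a` (divided by `n`)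
  have hb1 : (((b + 1 : ℕ) : ℝ) / n) = t * x + (1 - t) * z := by
    rw [ht, hx, hz]
    field_simp
    push_cast
    ring
  have ha1' : (((a - 1 : ℕ) : ℝ) / n) = (1 - t) * x + t * z := by
    rw [ht, hx, hz, Nat.cast_sub ha1]
    field_simp
    push_cast
    ring
  have h1 := Real.concaveOn_negMulLog.2 (Set.mem_Ici.2 hx0) (Set.mem_Ici.2 hz0) ht0
    (sub_nonneg.2 ht1) (by ring)
  have h2 := Real.concaveOn_negMulLog.2 (Set.mem_Ici.2 hx0) (Set.mem_Ici.2 hz0)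
    (sub_nonneg.2 ht1) ht0 (by ring)
  simp only [smul_eq_mul] at h1 h2
  rw [hb1, ha1']
  linarith

end Transfer

/-! ## Sorted vectors: the sum over any `m` indices is at most the sum of the first `m` -/

section Sorted

variable {N : ℕ}

/-- A strictly monotone map `Fin m → Fin N` dominates the index: `j ≤ f j`. [folklore] -/
theorem Fin.val_le_of_strictMono {m : ℕ} {f : Fin m → Fin N} (hf : StrictMono f) (j : Fin m) :
    (j : ℕ) ≤ f j := by
  obtain ⟨j, hj⟩ := j
  induction j with
  | zero => exact Nat.zero_le _
  | succ j ih =>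
    have h := hf (show (⟨j, by omega⟩ : Fin m) < ⟨j + 1, hj⟩ from Nat.lt_succ_self j)
    have := ih (by omega)
    exact Nat.succ_le_of_lt (lt_of_le_of_lt this h)

/-- For an antitone `y : Fin N → ℝ`, the sum of `y` over any set `T` of indices is at most the sum
over the first `|T|` indices. [folklore] -/
theorem Finset.sum_le_sum_prefix_of_antitone {y : Fin N → ℝ} (hy : Antitone y)
    (T : Finset (Fin N)) :
    ∑ i ∈ T, y i ≤ ∑ i ∈ Finset.univ.filter (fun i : Fin N => (i : ℕ) < T.card), y i := by
  classical
  have hcard : T.card ≤ N := by simpa using T.card_le_univ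
  set e := T.orderEmbOfFin rfl with he
  -- `∑_T y = ∑_j y (e j)`
  have h1 : ∑ i ∈ T, y i = ∑ j : Fin T.card, y (e j) := by
    conv_lhs => rw [← Finset.map_orderEmbOfFin_univ T rfl]
    rw [Finset.sum_map]
    rfl
  -- the first `|T|` indices, as the image of `Fin T.card`
  set ι' : Fin T.card → Fin N := fun j => ⟨j, lt_of_lt_of_le j.2 hcard⟩ with hι'
  have hinj : Function.Injective ι' := fun a b h => Fin.ext (by simpa [hι'] using congrArg Fin.val h)
  have h2 : Finset.univ.filter (fun i : Fin N => (i : ℕ) < T.card) = Finset.univ.image ι' := by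
    ext i
    simp only [Finset.mem_filter, Finset.mem_univ, true_and, Finset.mem_image, hι']
    constructor
    · intro hi
      exact ⟨⟨i, hi⟩, Fin.ext rfl⟩
    · rintro ⟨j, rfl⟩
      exact j.2
  rw [h1, h2, Finset.sum_image fun a _ b _ h => hinj h]
  refine Finset.sum_le_sum fun j _ => hy ?_
  change (⟨j, _⟩ : Fin N) ≤ e j
  rw [Fin.le_def]
  exact Fin.val_le_of_strictMono e.strictMono j

/-- `|{i : Fin N | i < m}| = min m N`. [folklore] -/
theorem card_filter_val_lt (N m : ℕ) :
    (Finset.univ.filter fun i : Fin N => (i : ℕ) < m).card = min m N := by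
  rw [← Finset.card_map Fin.valEmbedding]
  have : (Finset.univ.filter fun i : Fin N => (i : ℕ) < m).map Fin.valEmbedding =
      Finset.range (min m N) := by
    ext j
    simp only [Finset.mem_map, Finset.mem_filter, Finset.mem_univ, true_and,
      Fin.valEmbedding_apply, Finset.mem_range, lt_min_iff]
    constructor
    · rintro ⟨i, hi, rfl⟩
      exact ⟨hi, i.2⟩
    · rintro ⟨hm, hN⟩
      exact ⟨⟨j, hN⟩, hm, rfl⟩
  rw [this, Finset.card_range]

/-- Filtering `Fin N` by `i < |{i | i < m}|` is filtering by `i < m`. [folklore] -/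
theorem filter_val_lt_card_filter (N m : ℕ) :
    (Finset.univ.filter fun i : Fin N =>
        (i : ℕ) < (Finset.univ.filter fun i : Fin N => (i : ℕ) < m).card) =
      Finset.univ.filter fun i : Fin N => (i : ℕ) < m := by
  rw [card_filter_val_lt]
  ext i
  simp only [Finset.mem_filter, Finset.mem_univ, true_and, lt_min_iff]
  exact ⟨fun h => h.1, fun h => ⟨h, i.2⟩⟩

/-- Prefix sums of a vector are dominated by the prefix sums of its antitone rearrangement: if
`y ∘ σ` is antitone then `∑_{i < m} y i ≤ ∑_{i < m} y (σ i)`. [folklore] -/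
theorem sum_prefix_le_sum_prefix_comp_of_antitone (y : Fin N → ℝ) (σ : Equiv.Perm (Fin N))
    (h : Antitone (y ∘ σ)) (m : ℕ) :
    ∑ i ∈ Finset.univ.filter (fun i : Fin N => (i : ℕ) < m), y i ≤
      ∑ i ∈ Finset.univ.filter (fun i : Fin N => (i : ℕ) < m), y (σ i) := by
  classical
  set F := Finset.univ.filter (fun i : Fin N => (i : ℕ) < m) with hF
  -- rewrite the left sum over `T = σ⁻¹ F` of the antitone vector `y ∘ σ`
  have h1 : ∑ i ∈ F, y i = ∑ j ∈ F.image σ.symm, (y ∘ σ) j := by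
    rw [Finset.sum_image fun a _ b _ h => σ.symm.injective h]
    simp
  have hc : (F.image σ.symm).card = F.card := Finset.card_image_of_injective _ σ.symm.injective
  rw [h1]
  refine (Finset.sum_le_sum_prefix_of_antitone h _).trans (le_of_eq ?_)
  rw [hc, hF, filter_val_lt_card_filter]
  rfl

end Sorted

/-! ## The transfer induction -/

section Induction

variable {N : ℕ}

/-- Prefix sums `∑_{i < m}` of a vector `Fin N → ℕ`, cast to `ℝ` termwise. [folklore] -/
theorem sum_prefix_natCast (u : Fin N → ℕ) (m : ℕ) :
    ((∑ i ∈ Finset.univ.filter (fun i : Fin N => (i : ℕ) < m), u i : ℕ) : ℝ) =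
      ∑ i ∈ Finset.univ.filter (fun i : Fin N => (i : ℕ) < m), (u i : ℝ) := by
  push_cast
  rfl

/-- **The transfer induction** (integer Karamata / Hardy–Littlewood–Pólya): let `u, v : Fin N → ℕ`
be antitone with equal sums and `∑_{i<m} v ≤ ∑_{i<m} u` for all `m` (`v ⊴ u`), and let `g` satisfy
the transfer inequality `g a + g b ≤ g (a-1) + g (b+1)` for `b < a`. Then `∑ g (u i) ≤ ∑ g (v i)`.
[folklore] -/
theorem sum_le_sum_of_antitone_of_prefix_le (g : ℕ → ℝ)
    (hg : ∀ a b : ℕ, b < a → g a + g b ≤ g (a - 1) + g (b + 1))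
    (v : Fin N → ℕ) (hv : Antitone v) (u : Fin N → ℕ) (hu : Antitone u)
    (hsum : ∑ i, u i = ∑ i, v i)
    (hpre : ∀ m : ℕ, ∑ i ∈ Finset.univ.filter (fun i : Fin N => (i : ℕ) < m), v i ≤
      ∑ i ∈ Finset.univ.filter (fun i : Fin N => (i : ℕ) < m), u i) :
    ∑ i, g (u i) ≤ ∑ i, g (v i) := by
  classical
  -- strong induction on `Q = ∑ u_i²`
  suffices H : ∀ (Q : ℕ) (u : Fin N → ℕ), Antitone u → ∑ i, u i ^ 2 = Q → ∑ i, u i = ∑ i, v i →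
      (∀ m : ℕ, ∑ i ∈ Finset.univ.filter (fun i : Fin N => (i : ℕ) < m), v i ≤
        ∑ i ∈ Finset.univ.filter (fun i : Fin N => (i : ℕ) < m), u i) →
      ∑ i, g (u i) ≤ ∑ i, g (v i) from H _ u hu rfl hsum hpre
  intro Q
  induction Q using Nat.strong_induction_on with
  | _ Q ih =>
  intro u hu hQ hsum hpre
  by_cases huv : u = v
  · subst huv
    exact le_rfl
  -- the first index `k` where `u` and `v` differ; there `v k < u k`
  have hne : (Finset.univ.filter fun i : Fin N => u i ≠ v i).Nonempty := by
    by_contra h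
    rw [Finset.not_nonempty_iff_eq_empty, Finset.filter_eq_empty_iff] at h
    exact huv (funext fun i => not_not.1 (h (Finset.mem_univ i)))
  set k := (Finset.univ.filter fun i : Fin N => u i ≠ v i).min' hne with hk
  have hk_mem : u k ≠ v k := (Finset.mem_filter.1 (Finset.min'_mem _ hne)).2
  have hk_min : ∀ i : Fin N, i < k → u i = v i := by
    intro i hi
    by_contra h
    have := Finset.min'_le (Finset.univ.filter fun i : Fin N => u i ≠ v i) i
      (Finset.mem_filter.2 ⟨Finset.mem_univ i, h⟩)
    rw [← hk] at this
    exact absurd hi (not_lt.2 this)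
  -- prefix sums up to `k` agree
  have hpre_eq : ∀ m : ℕ, m ≤ k →
      ∑ i ∈ Finset.univ.filter (fun i : Fin N => (i : ℕ) < m), u i =
        ∑ i ∈ Finset.univ.filter (fun i : Fin N => (i : ℕ) < m), v i := by
    intro m hm
    refine Finset.sum_congr rfl fun i hi => hk_min i ?_
    have := (Finset.mem_filter.1 hi).2
    exact Fin.lt_def.2 (lt_of_lt_of_le this hm)
  have hvk : v k < u k := by
    have h := hpre (k + 1)
    have hsplit : ∀ w : Fin N → ℕ, ∑ i ∈ Finset.univ.filter (fun i : Fin N => (i : ℕ) < k + 1), w i =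
        ∑ i ∈ Finset.univ.filter (fun i : Fin N => (i : ℕ) < k), w i + w k := by
      intro w
      have : Finset.univ.filter (fun i : Fin N => (i : ℕ) < (k : ℕ) + 1) =
          insert k (Finset.univ.filter (fun i : Fin N => (i : ℕ) < k)) := by
        ext i
        simp only [Finset.mem_filter, Finset.mem_univ, true_and, Finset.mem_insert]
        constructor
        · intro hi
          rcases Nat.lt_succ_iff_lt_or_eq.1 hi with h | h
          · exact Or.inr h
          · exact Or.inl (Fin.ext h)
        · rintro (rfl | h)
          · exact Nat.lt_succ_self _
          · exact Nat.lt_succ_of_lt h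
      rw [this, Finset.sum_insert (by simp), add_comm]
    rw [hsplit, hsplit, hpre_eq k le_rfl] at h
    have : v k ≤ u k := by omega
    exact lt_of_le_of_ne this (Ne.symm hk_mem)
  -- some later index `l` has `u l < v l` (the totals agree)
  have hex : ∃ i : Fin N, k < i ∧ u i < v i := by
    by_contra h
    push Not at h
    -- then `u ≥ v` termwise with strict inequality at `k`: contradiction with equal sums
    have hge : ∀ i, v i ≤ u i := by
      intro i
      rcases lt_trichotomy i k with hi | rfl | hi
      · exact (hk_min i hi).symm.le
      · exact hvk.le
      · exact h i hi
    have hlt : ∑ i, v i < ∑ i, u i :=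
      Finset.sum_lt_sum (fun i _ => hge i) ⟨k, Finset.mem_univ k, hvk⟩
    omega
  have hlne : (Finset.univ.filter fun i : Fin N => k < i ∧ u i < v i).Nonempty := by
    obtain ⟨i, hi⟩ := hex
    exact ⟨i, Finset.mem_filter.2 ⟨Finset.mem_univ i, hi⟩⟩
  set l := (Finset.univ.filter fun i : Fin N => k < i ∧ u i < v i).min' hlne with hl
  have hl_mem : k < l ∧ u l < v l := (Finset.mem_filter.1 (Finset.min'_mem _ hlne)).2
  have hl_min : ∀ i : Fin N, k < i → i < l → v i ≤ u i := by
    intro i hki hil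
    by_contra h
    push Not at h
    have := Finset.min'_le (Finset.univ.filter fun i : Fin N => k < i ∧ u i < v i) i
      (Finset.mem_filter.2 ⟨Finset.mem_univ i, hki, h⟩)
    rw [← hl] at this
    exact absurd hil (not_lt.2 this)
  have hkl : k ≠ l := ne_of_lt hl_mem.1
  -- `u k ≥ u l + 2`
  have hukl : u l + 2 ≤ u k := by
    have h1 := hv hl_mem.1.le  -- v l ≤ v k
    have h2 := hl_mem.2
    omega
  -- the transfer `u' = u - e_k + e_l`
  set u' : Fin N → ℕ := fun i => if i = k then u k - 1 else if i = l then u l + 1 else u i with hu'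
  have hu'k : u' k = u k - 1 := by simp [hu']
  have hu'l : u' l = u l + 1 := by simp [hu', Ne.symm hkl]
  have hu'o : ∀ i, i ≠ k → i ≠ l → u' i = u i := fun i h1 h2 => by simp [hu', h1, h2]
  -- generic splitting of a sum over `Fin N` at `k` and `l`
  have split : ∀ (f : Fin N → ℝ), ∑ i, f i =
      f k + f l + ∑ i ∈ (Finset.univ.erase k).erase l, f i := by
    intro f
    rw [← Finset.add_sum_erase _ _ (Finset.mem_univ k), ← Finset.add_sum_erase _ _
      (Finset.mem_erase.2 ⟨Ne.symm hkl, Finset.mem_univ l⟩), add_assoc]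
  have split_nat : ∀ (f : Fin N → ℕ), ∑ i, f i =
      f k + f l + ∑ i ∈ (Finset.univ.erase k).erase l, f i := by
    intro f
    rw [← Finset.add_sum_erase _ _ (Finset.mem_univ k), ← Finset.add_sum_erase _ _
      (Finset.mem_erase.2 ⟨Ne.symm hkl, Finset.mem_univ l⟩), add_assoc]
  have hrest : ∀ i ∈ (Finset.univ.erase k).erase l, u' i = u i := by
    intro i hi
    simp only [Finset.mem_erase] at hi
    exact hu'o i hi.2.1 hi.1
  -- sums: `∑ u' = ∑ u`
  set R := (Finset.univ.erase k).erase l with hR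
  have hS1 : ∑ i ∈ R, u' i = ∑ i ∈ R, u i := Finset.sum_congr rfl hrest
  have hS2 : ∑ i ∈ R, u' i ^ 2 = ∑ i ∈ R, u i ^ 2 :=
    Finset.sum_congr rfl fun i hi => by rw [hrest i hi]
  have hS3 : ∑ i ∈ R, g (u' i) = ∑ i ∈ R, g (u i) :=
    Finset.sum_congr rfl fun i hi => by rw [hrest i hi]
  have h1k : 1 ≤ u k := by omega
  have hsum' : ∑ i, u' i = ∑ i, u i := by
    rw [split_nat u', split_nat u, hS1, hu'k, hu'l]
    have : u k - 1 + (u l + 1) = u k + u l := by omega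
    rw [this]
  -- squares decrease strictly
  have hQ' : ∑ i, u' i ^ 2 < ∑ i, u i ^ 2 := by
    rw [split_nat (fun i => u' i ^ 2), split_nat (fun i => u i ^ 2)]
    rw [hS2, hu'k, hu'l]
    have key : (u k - 1) ^ 2 + (u l + 1) ^ 2 < u k ^ 2 + u l ^ 2 := by
      zify [h1k]
      nlinarith
    exact Nat.add_lt_add_right key _
  -- `g`-sums do not decrease
  have hg' : ∑ i, g (u i) ≤ ∑ i, g (u' i) := by
    rw [split (fun i => g (u i)), split (fun i => g (u' i))]
    rw [hS3, hu'k, hu'l]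
    have := hg (u k) (u l) (by omega)
    linarith
  -- prefix sums of `u'` still dominate those of `v`
  have hpre' : ∀ m : ℕ, ∑ i ∈ Finset.univ.filter (fun i : Fin N => (i : ℕ) < m), v i ≤
      ∑ i ∈ Finset.univ.filter (fun i : Fin N => (i : ℕ) < m), u' i := by
    intro m
    set F := Finset.univ.filter (fun i : Fin N => (i : ℕ) < m) with hF
    by_cases hkm : (k : ℕ) < m
    · by_cases hlm : (l : ℕ) < m
      · -- both `k, l ∈ F`: the sum is unchanged
        have hkF : k ∈ F := Finset.mem_filter.2 ⟨Finset.mem_univ _, hkm⟩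
        have hlF : l ∈ F.erase k := Finset.mem_erase.2 ⟨Ne.symm hkl, Finset.mem_filter.2
          ⟨Finset.mem_univ _, hlm⟩⟩
        have hs : ∀ w : Fin N → ℕ, ∑ i ∈ F, w i = w k + w l + ∑ i ∈ (F.erase k).erase l, w i := by
          intro w
          rw [← Finset.add_sum_erase _ _ hkF, ← Finset.add_sum_erase _ _ hlF, add_assoc]
        have hrest' : ∀ i ∈ (F.erase k).erase l, u' i = u i := by
          intro i hi
          simp only [Finset.mem_erase] at hi
          exact hu'o i hi.2.1 hi.1
        have hS : ∑ i ∈ (F.erase k).erase l, u' i = ∑ i ∈ (F.erase k).erase l, u i :=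
          Finset.sum_congr rfl hrest'
        have : ∑ i ∈ F, u' i = ∑ i ∈ F, u i := by
          rw [hs u', hs u, hS, hu'k, hu'l]
          have : u k - 1 + (u l + 1) = u k + u l := by omega
          rw [this]
        rw [this]
        exact hpre m
      · -- `k ∈ F`, `l ∉ F`: the sum drops by one, but the slack is at least `u k - v k ≥ 1`
        have hkF : k ∈ F := Finset.mem_filter.2 ⟨Finset.mem_univ _, hkm⟩
        have hs : ∀ w : Fin N → ℕ, ∑ i ∈ F, w i = w k + ∑ i ∈ F.erase k, w i := by
          intro w
          rw [← Finset.add_sum_erase _ _ hkF]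
        have hrest' : ∀ i ∈ F.erase k, u' i = u i := by
          intro i hi
          simp only [Finset.mem_erase, hF, Finset.mem_filter, Finset.mem_univ, true_and] at hi
          refine hu'o i hi.1 ?_
          rintro rfl
          exact hlm hi.2
        -- termwise `v ≤ u` on `F.erase k` (indices `< m ≤ l`, different from `k`)
        have hterm : ∀ i ∈ F.erase k, v i ≤ u i := by
          intro i hi
          simp only [Finset.mem_erase, hF, Finset.mem_filter, Finset.mem_univ, true_and] at hi
          rcases lt_or_gt_of_ne hi.1 with h | h
          · exact (hk_min i h).symm.le
          · refine hl_min i h ?_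
            rw [Fin.lt_def]
            omega
        have h1 : ∑ i ∈ F.erase k, v i ≤ ∑ i ∈ F.erase k, u i := Finset.sum_le_sum hterm
        have hS : ∑ i ∈ F.erase k, u' i = ∑ i ∈ F.erase k, u i := Finset.sum_congr rfl hrest'
        rw [hs v, hs u', hS, hu'k]
        have := hvk
        omega
    · -- `k ∉ F`: then also `l ∉ F`, the sum is unchanged
      have hrest' : ∀ i ∈ F, u' i = u i := by
        intro i hi
        simp only [hF, Finset.mem_filter, Finset.mem_univ, true_and] at hi
        refine hu'o i ?_ ?_
        · rintro rfl; exact hkm hi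
        · rintro rfl
          exact hkm (lt_trans (Fin.lt_def.1 hl_mem.1) hi)
      rw [Finset.sum_congr rfl hrest']
      exact hpre m
  -- sort `u'` decreasingly: `u'' = u' ∘ σ` antitone
  set τ : Equiv.Perm (Fin N) := Tuple.sort u' with hτ
  set σ : Equiv.Perm (Fin N) := Fin.revPerm.trans τ with hσ
  set u'' : Fin N → ℕ := u' ∘ σ with hu''
  have hmono : Monotone (u' ∘ τ) := Tuple.monotone_sort u'
  have hu''anti : Antitone u'' := by
    intro i j hij
    change u' (τ (Fin.rev j)) ≤ u' (τ (Fin.rev i))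
    exact hmono (Fin.rev_le_rev.2 hij)
  have hsumσ : ∀ (f : Fin N → ℕ), ∑ i, f (σ i) = ∑ i, f i := fun f => Equiv.sum_comp σ f
  have hsum'' : ∑ i, u'' i = ∑ i, v i := by
    rw [hu'', show (∑ i, (u' ∘ σ) i) = ∑ i, u' (σ i) from rfl, hsumσ u', hsum', hsum]
  have hQ'' : ∑ i, u'' i ^ 2 < Q := by
    rw [← hQ, hu'', show (∑ i, (u' ∘ σ) i ^ 2) = ∑ i, (fun j => u' j ^ 2) (σ i) from rfl,
      hsumσ (fun j => u' j ^ 2)]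
    exact hQ'
  have hg'' : ∑ i, g (u'' i) = ∑ i, g (u' i) := by
    rw [hu'', show (∑ i, g ((u' ∘ σ) i)) = ∑ i, (fun j => g (u' j)) (σ i) from rfl]
    exact Equiv.sum_comp σ (fun j => g (u' j))
  have hpre'' : ∀ m : ℕ, ∑ i ∈ Finset.univ.filter (fun i : Fin N => (i : ℕ) < m), v i ≤
      ∑ i ∈ Finset.univ.filter (fun i : Fin N => (i : ℕ) < m), u'' i := by
    intro m
    refine (hpre' m).trans ?_
    -- cast to `ℝ` and use the rearrangement lemma
    have h := sum_prefix_le_sum_prefix_comp_of_antitone (fun i => (u' i : ℝ)) σ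
      (fun i j hij => by
        change ((u' (σ j) : ℕ) : ℝ) ≤ ((u' (σ i) : ℕ) : ℝ)
        exact_mod_cast (hu''anti hij : u' (σ j) ≤ u' (σ i))) m
    have h' : ((∑ i ∈ Finset.univ.filter (fun i : Fin N => (i : ℕ) < m), u' i : ℕ) : ℝ) ≤
        ((∑ i ∈ Finset.univ.filter (fun i : Fin N => (i : ℕ) < m), u'' i : ℕ) : ℝ) := by
      push_cast
      exact h
    exact_mod_cast h'
  -- conclude by induction
  calc ∑ i, g (u i) ≤ ∑ i, g (u' i) := hg'
    _ = ∑ i, g (u'' i) := hg''.symm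
    _ ≤ ∑ i, g (v i) := ih _ hQ'' u'' hu''anti rfl hsum'' hpre''

end Induction

/-! ## From partitions and content functions to sorted vectors -/

section Partition

variable {n : ℕ}

/-- The `i`-th largest part `λ_i` (zero beyond the length) is antitone in `i`. [folklore] -/
theorem sortedParts_getD_antitone (lam : Nat.Partition n) :
    Antitone fun i : ℕ => lam.sortedParts.getD i 0 := by
  intro i j hij
  simp only
  by_cases hj : j < lam.sortedParts.length
  · have hi : i < lam.sortedParts.length := lt_of_le_of_lt hij hj
    rw [List.getD_eq_getElem _ _ hi, List.getD_eq_getElem _ _ hj]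
    rcases hij.eq_or_lt with h | h
    · subst h; exact le_rfl
    · have hs := lam.sortedGE_sortedParts
      exact (List.pairwise_iff_getElem.1 hs.pairwise) i j hi hj h
  · rw [List.getD_eq_default _ _ (not_lt.1 hj)]
    exact Nat.zero_le _

/-- `∑_{i < m} λ_i = (λ.sortedParts.take m).sum` for the zero-padded parts on `Fin N`, `ℓ(λ) ≤ N`.
[folklore] -/
theorem sum_prefix_sortedParts_getD (lam : Nat.Partition n) {N : ℕ}
    (hN : lam.sortedParts.length ≤ N) (m : ℕ) :
    ∑ i ∈ Finset.univ.filter (fun i : Fin N => (i : ℕ) < m), lam.sortedParts.getD i 0 =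
      (lam.sortedParts.take m).sum := by
  classical
  set L := lam.sortedParts with hL
  -- both sides equal `∑_{i < min m N} L.getD i 0`
  have lhs : ∑ i ∈ Finset.univ.filter (fun i : Fin N => (i : ℕ) < m), L.getD i 0 =
      ∑ i ∈ Finset.range (min m N), L.getD i 0 := by
    rw [Finset.range_eq_Ico]
    refine Finset.sum_nbij (fun i => (i : ℕ)) ?_ ?_ ?_ ?_
    · intro i hi
      simp only [Finset.mem_filter, Finset.mem_univ, true_and] at hi
      simp [lt_min hi i.2]
    · intro a _ b _ h
      exact Fin.ext h
    · intro j hj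
      simp only [Finset.coe_Ico, Set.mem_Ico, lt_min_iff] at hj
      exact ⟨⟨j, hj.2.2⟩, by simp [hj.2.1], rfl⟩
    · intro i _; rfl
  rw [lhs]
  -- `∑_{i < K} L.getD i 0 = (L.take K).sum` for every `K`
  have key : ∀ K : ℕ, ∑ i ∈ Finset.range K, L.getD i 0 = (L.take K).sum := by
    intro K
    induction K with
    | zero => simp
    | succ K ih =>
      rw [Finset.sum_range_succ, ih]
      by_cases hK : K < L.length
      · rw [List.getD_eq_getElem _ _ hK, ← List.take_concat_get' L K hK, List.sum_append]
        simp
      · push Not at hK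
        rw [List.getD_eq_default _ _ hK, List.take_of_length_le hK,
          List.take_of_length_le (by omega)]
        simp
  rw [key]
  -- `take (min m N) = take m` as `N ≥ length`
  rcases le_total m N with h | h
  · rw [min_eq_left h]
  · rw [min_eq_right h, List.take_of_length_le hN, List.take_of_length_le (hN.trans h)]

/-- `∑_{i : Fin N} g (λ_i)` over the zero-padded parts equals `∑_{p ∈ λ.parts} g p` plus
`(N - ℓ(λ)) g 0`. [folklore] -/
theorem sum_sortedParts_getD_eq (lam : Nat.Partition n) {N : ℕ} (hN : lam.sortedParts.length ≤ N)
    (g : ℕ → ℝ) :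
    ∑ i : Fin N, g (lam.sortedParts.getD i 0) =
      (lam.parts.map g).sum + ((N - lam.sortedParts.length : ℕ) : ℝ) * g 0 := by
  classical
  set L := lam.sortedParts with hL
  have hparts : (lam.parts.map g).sum = (L.map g).sum := by
    rw [hL, Nat.Partition.sortedParts, ← Multiset.sum_coe, ← Multiset.map_coe, Multiset.sort_eq]
  rw [hparts]
  -- sum over `Fin N` as a range sum
  have h1 : ∑ i : Fin N, g (L.getD i 0) = ∑ i ∈ Finset.range N, g (L.getD i 0) :=
    (Fin.sum_univ_eq_sum_range (fun i => g (L.getD i 0)) N)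
  rw [h1, ← Finset.sum_range_add_sum_Ico _ hN]
  congr 1
  · -- `∑_{i < length} g (L[i]) = (L.map g).sum`
    have : ∀ (L : List ℕ), ∑ i ∈ Finset.range L.length, g (L.getD i 0) = (L.map g).sum := by
      intro L
      induction L with
      | nil => simp
      | cons a L ih =>
        rw [List.length_cons, Finset.sum_range_succ', List.map_cons, List.sum_cons]
        simp only [List.getD_cons_succ, List.getD_cons_zero]
        rw [ih, add_comm]
    exact this L
  · have hz : ∀ i ∈ Finset.Ico L.length N, g (L.getD i 0) = g 0 := fun i hi => by
      rw [List.getD_eq_default _ _ (Finset.mem_Ico.1 hi).1]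
    rw [Finset.sum_congr rfl hz, Finset.sum_const, Nat.card_Ico, nsmul_eq_mul]

variable {α : Type*} [Fintype α]

/-- If `c : α → ℕ` with `∑ c = n` is dominated by `λ ⊢ n` in the subset-sum sense, then `λ` has at
most `|α|` parts. [folklore] -/
theorem length_sortedParts_le_card_of_dominated (lam : Nat.Partition n) (c : α → ℕ)
    (hc : ∑ a, c a = n) (hdom : ∀ S : Finset α, ∑ a ∈ S, c a ≤ (lam.sortedParts.take S.card).sum) :
    lam.sortedParts.length ≤ Fintype.card α := by
  by_contra h
  push Not at h
  set L := lam.sortedParts with hL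
  have hall := hdom Finset.univ
  rw [hc, Finset.card_univ] at hall
  -- `(L.take |α|).sum < L.sum = n` since the dropped parts are positive
  have hlt : (L.take (Fintype.card α)).sum < L.sum := by
    conv_rhs => rw [← List.take_append_drop (Fintype.card α) L]
    rw [List.sum_append]
    have hne : L.drop (Fintype.card α) ≠ [] := by
      intro he
      have := List.drop_eq_nil_iff.1 he
      omega
    have hpos : 0 < (L.drop (Fintype.card α)).sum := by
      obtain ⟨x, hx⟩ := List.exists_mem_of_ne_nil _ hne
      have hx' : 0 < x := lam.pos_of_mem_sortedParts (List.mem_of_mem_drop hx)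
      exact lt_of_lt_of_le hx' (List.single_le_sum (fun _ _ => Nat.zero_le _) _ hx)
    omega
  rw [hL, lam.sum_sortedParts] at hlt
  rw [hL] at hall
  omega

/-- **Schur-concavity of `∑ g` under majorisation by a partition** (transfer form): for `g` with
the transfer inequality and a content `c : α → ℕ`, `∑ c = n`, dominated by `λ ⊢ n`
(`∑_{a ∈ S} c a ≤ λ₁ + ⋯ + λ_{|S|}` for all `S`), one has
`∑_{p ∈ λ} g p + (|α| - ℓ(λ)) g 0 ≤ ∑_a g (c a)`. [folklore] -/
theorem sum_parts_le_sum_of_dominated (g : ℕ → ℝ)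
    (hg : ∀ a b : ℕ, b < a → g a + g b ≤ g (a - 1) + g (b + 1)) (lam : Nat.Partition n) (c : α → ℕ)
    (hc : ∑ a, c a = n) (hdom : ∀ S : Finset α, ∑ a ∈ S, c a ≤ (lam.sortedParts.take S.card).sum) :
    (lam.parts.map g).sum + ((Fintype.card α - lam.sortedParts.length : ℕ) : ℝ) * g 0 ≤
      ∑ a, g (c a) := by
  classical
  set N := Fintype.card α with hNdef
  have hN : lam.sortedParts.length ≤ N := length_sortedParts_le_card_of_dominated lam c hc hdom
  -- transport `c` to `Fin N` and sort it decreasingly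
  set e : α ≃ Fin N := Fintype.equivFin α with he
  set c' : Fin N → ℕ := c ∘ e.symm with hc'
  set τ : Equiv.Perm (Fin N) := Tuple.sort c' with hτ
  set σ : Equiv.Perm (Fin N) := Fin.revPerm.trans τ with hσ
  set v : Fin N → ℕ := c' ∘ σ with hv
  have hmono : Monotone (c' ∘ τ) := Tuple.monotone_sort c'
  have hvanti : Antitone v := by
    intro i j hij
    change c' (τ (Fin.rev j)) ≤ c' (τ (Fin.rev i))
    exact hmono (Fin.rev_le_rev.2 hij)
  -- the padded parts
  set u : Fin N → ℕ := fun i => lam.sortedParts.getD i 0 with hu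
  have huanti : Antitone u := fun i j hij => sortedParts_getD_antitone lam (Fin.le_def.1 hij)
  -- sums
  have hsumv : ∑ i, v i = n := by
    rw [hv, show (∑ i, (c' ∘ σ) i) = ∑ i, c' (σ i) from rfl, Equiv.sum_comp σ c', hc',
      show (∑ i, (c ∘ e.symm) i) = ∑ i, c (e.symm i) from rfl, Equiv.sum_comp e.symm c, hc]
  have hsumu : ∑ i, u i = n := by
    have h := sum_prefix_sortedParts_getD lam hN N
    have hfilt : Finset.univ.filter (fun i : Fin N => (i : ℕ) < N) = Finset.univ := by
      ext i; simp
    rw [hfilt] at h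
    rw [hu, h, List.take_of_length_le hN, lam.sum_sortedParts]
  -- prefix domination `∑_{i<m} v ≤ ∑_{i<m} u`
  have hpre : ∀ m : ℕ, ∑ i ∈ Finset.univ.filter (fun i : Fin N => (i : ℕ) < m), v i ≤
      ∑ i ∈ Finset.univ.filter (fun i : Fin N => (i : ℕ) < m), u i := by
    intro m
    set F := Finset.univ.filter (fun i : Fin N => (i : ℕ) < m) with hF
    -- the left side is `∑_{a ∈ S} c a` for `S = e.symm (σ F)`
    set S : Finset α := F.image (fun i => e.symm (σ i)) with hS
    have hinj : Function.Injective fun i : Fin N => e.symm (σ i) :=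
      e.symm.injective.comp σ.injective
    have hSsum : ∑ a ∈ S, c a = ∑ i ∈ F, v i := by
      rw [hS, Finset.sum_image fun a _ b _ h => hinj h]
      rfl
    have hScard : S.card = F.card := Finset.card_image_of_injective _ hinj
    have h1 := hdom S
    rw [hSsum, hScard] at h1
    refine h1.trans ?_
    rw [hu, sum_prefix_sortedParts_getD lam hN m]
    -- `F.card = min m N` and `take (F.card) = take m` up to the length bound
    have hcard : F.card = min m N := card_filter_val_lt N m
    rw [hcard]
    rcases le_total m N with h | h
    · rw [min_eq_left h]
    · rw [min_eq_right h, List.take_of_length_le hN, List.take_of_length_le (hN.trans h)]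
  -- the transfer induction
  have main := sum_le_sum_of_antitone_of_prefix_le g hg v hvanti u huanti
    (hsumu.trans hsumv.symm) hpre
  -- rewrite both sides
  have lhs : ∑ i, g (u i) = (lam.parts.map g).sum + ((N - lam.sortedParts.length : ℕ) : ℝ) * g 0 :=
    sum_sortedParts_getD_eq lam hN g
  have rhs : ∑ i, g (v i) = ∑ a, g (c a) := by
    rw [hv, show (∑ i, g ((c' ∘ σ) i)) = ∑ i, (fun j => g (c' j)) (σ i) from rfl,
      Equiv.sum_comp σ (fun j => g (c' j)), hc',
      show (∑ i, g ((c ∘ e.symm) i)) = ∑ i, (fun a => g (c a)) (e.symm i) from rfl,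
      Equiv.sum_comp e.symm (fun a => g (c a))]
  rw [← lhs, ← rhs]
  exact main

/-- **Schur-concavity of the Shannon entropy under majorisation by a partition** (nats): for a
content `c : α → ℕ` with `∑ c = n` dominated by `λ ⊢ n` in the subset-sum sense,
`∑_{p ∈ λ} -(p/n) log (p/n) ≤ ∑_a -(c_a/n) log (c_a/n)`, i.e. `H(λ̄) ≤ H(c/n)` (CVZ Remark 3.33:
"the Shannon entropy is Schur-concave"). [folklore] -/
theorem sum_negMulLog_parts_le_of_dominated (lam : Nat.Partition n) (c : α → ℕ)
    (hc : ∑ a, c a = n) (hdom : ∀ S : Finset α, ∑ a ∈ S, c a ≤ (lam.sortedParts.take S.card).sum) :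
    (lam.parts.map fun p : ℕ => negMulLog ((p : ℝ) / n)).sum ≤
      ∑ a, negMulLog ((c a : ℝ) / n) := by
  have h := sum_parts_le_sum_of_dominated (fun m : ℕ => negMulLog ((m : ℝ) / n))
    (fun a b hba => negMulLog_transfer_le n hba) lam c hc hdom
  simpa using h

/-- **`H(λ̄) ≤ H(c/n)` in bits**: the entropy of the normalised partition `λ ⊢ n`
(`partitionEntropy`, `QuantumFunctionalsUpper.lean`) is at most the Shannon entropy of the
normalised content `c/n` whenever `c` (`∑ c = n`) is dominated by `λ`. [folklore] -/
theorem partitionEntropy_le_of_dominated (lam : Nat.Partition n) (c : α → ℕ) (hc : ∑ a, c a = n)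
    (hdom : ∀ S : Finset α, ∑ a ∈ S, c a ≤ (lam.sortedParts.take S.card).sum) :
    partitionEntropy lam ≤ shannonEntropy fun a => (c a : ℝ) / n := by
  rw [partitionEntropy_def, shannonEntropy_def]
  exact div_le_div_of_nonneg_right (sum_negMulLog_parts_le_of_dominated lam c hc hdom)
    (Real.log_nonneg one_le_two)

end Partition

/-! ## Subadditivity of the Shannon entropy -/

section Subadditivity

variable {α β : Type*} [Fintype α] [Fintype β]

/-- **Subadditivity of the Shannon entropy** (independence bound): for a probability vector `P` on
`α × β` with marginals `P₁(a) = ∑_b P(a,b)`, `P₂(b) = ∑_a P(a,b)`, `H(P) ≤ H(P₁) + H(P₂)` (Gibbs'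
inequality against `P₁ ⊗ P₂`). [folklore] -/
theorem shannonEntropy_le_shannonEntropy_fst_add_snd {P : α × β → ℝ}
    (hP : P ∈ stdSimplex ℝ (α × β)) :
    shannonEntropy P ≤
      shannonEntropy (fun a => ∑ b, P (a, b)) + shannonEntropy (fun b => ∑ a, P (a, b)) := by
  classical
  set P₁ : α → ℝ := fun a => ∑ b, P (a, b) with hP₁
  set P₂ : β → ℝ := fun b => ∑ a, P (a, b) with hP₂
  have h10 : ∀ a, 0 ≤ P₁ a := fun a => Finset.sum_nonneg fun b _ => hP.1 _
  have h20 : ∀ b, 0 ≤ P₂ b := fun b => Finset.sum_nonneg fun a _ => hP.1 _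
  have hsum : ∑ x, P x = 1 := hP.2
  have h11 : ∑ a, P₁ a = 1 := by
    rw [← hsum, Fintype.sum_prod_type]
  have h21 : ∑ b, P₂ b = 1 := by
    rw [← hsum, Fintype.sum_prod_type, Finset.sum_comm]
  have hle1 : ∀ x : α × β, P x ≤ P₁ x.1 := fun x =>
    Finset.single_le_sum (f := fun b => P (x.1, b)) (fun b _ => hP.1 _) (Finset.mem_univ x.2)
  have hle2 : ∀ x : α × β, P x ≤ P₂ x.2 := fun x =>
    Finset.single_le_sum (f := fun a => P (a, x.2)) (fun a _ => hP.1 _) (Finset.mem_univ x.1)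
  -- reference vector `Q = P₁ ⊗ P₂`
  set Q : α × β → ℝ := fun x => P₁ x.1 * P₂ x.2 with hQ
  have hQ0 : ∀ x, 0 ≤ Q x := fun x => mul_nonneg (h10 _) (h20 _)
  have hQ1 : ∑ x, Q x ≤ 1 := by
    rw [Fintype.sum_prod_type]
    simp only [hQ]
    rw [← Finset.sum_mul_sum, h11, h21, one_mul]
  have hpos : ∀ x, P x ≠ 0 → 0 < P₁ x.1 ∧ 0 < P₂ x.2 := by
    intro x hx
    have hx' : 0 < P x := lt_of_le_of_ne (hP.1 x) (Ne.symm hx)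
    exact ⟨lt_of_lt_of_le hx' (hle1 x), lt_of_lt_of_le hx' (hle2 x)⟩
  have hPQ : ∀ x, P x ≠ 0 → 0 < Q x := fun x hx => mul_pos (hpos x hx).1 (hpos x hx).2
  refine (shannonEntropy_le_sum_mul_neg_logb hP.1 hsum hQ0 hQ1 hPQ).trans (le_of_eq ?_)
  -- `-log (P₁ P₂) = -log P₁ - log P₂` on the support of `P`
  have hlog : ∀ x : α × β, P x * (-Real.log (Q x) / Real.log 2) =
      P x * (-Real.log (P₁ x.1) / Real.log 2) + P x * (-Real.log (P₂ x.2) / Real.log 2) := by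
    intro x
    rcases eq_or_ne (P x) 0 with hx | hx
    · simp [hx]
    · rw [hQ]
      simp only
      rw [Real.log_mul (hpos x hx).1.ne' (hpos x hx).2.ne']
      ring
  rw [Finset.sum_congr rfl fun x _ => hlog x, Finset.sum_add_distrib]
  congr 1
  · rw [shannonEntropy_def, Finset.sum_div, Fintype.sum_prod_type]
    refine Finset.sum_congr rfl fun a _ => ?_
    simp only
    rw [← Finset.sum_mul, Real.negMulLog]
    ring
  · rw [shannonEntropy_def, Finset.sum_div, Fintype.sum_prod_type, Finset.sum_comm]
    refine Finset.sum_congr rfl fun b _ => ?_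
    simp only
    rw [← Finset.sum_mul, Real.negMulLog]
    ring

/-- **Subadditivity for contents** (nats): for `c : α × β → ℕ` with `∑ c = n`, row sums
`r a = ∑_b c(a,b)` and column sums `s b = ∑_a c(a,b)`,
`∑_{(a,b)} -(c/n) log (c/n) ≤ ∑_a -(r_a/n) log (r_a/n) + ∑_b -(s_b/n) log (s_b/n)`. [folklore] -/
theorem sum_negMulLog_div_le_rows_add_cols (c : α × β → ℕ) {n : ℕ} (hn : 0 < n)
    (hc : ∑ x, c x = n) :
    ∑ x, negMulLog ((c x : ℝ) / n) ≤
      ∑ a, negMulLog (((∑ b, c (a, b) : ℕ) : ℝ) / n) +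
        ∑ b, negMulLog (((∑ a, c (a, b) : ℕ) : ℝ) / n) := by
  classical
  have hn' : (0 : ℝ) < n := by exact_mod_cast hn
  set P : α × β → ℝ := fun x => (c x : ℝ) / n with hP
  have hPs : P ∈ stdSimplex ℝ (α × β) := by
    refine ⟨fun x => by positivity, ?_⟩
    simp only [hP]
    rw [← Finset.sum_div, ← Nat.cast_sum, hc, div_self hn'.ne']
  have h := shannonEntropy_le_shannonEntropy_fst_add_snd hPs
  have h2 : 0 < Real.log 2 := Real.log_pos one_lt_two
  rw [shannonEntropy_def, shannonEntropy_def, shannonEntropy_def, ← add_div,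
    div_le_div_iff_of_pos_right h2] at h
  have e1 : ∀ a, (∑ b, P (a, b)) = ((∑ b, c (a, b) : ℕ) : ℝ) / n := by
    intro a
    simp only [hP]
    rw [← Finset.sum_div, ← Nat.cast_sum]
  have e2 : ∀ b, (∑ a, P (a, b)) = ((∑ a, c (a, b) : ℕ) : ℝ) / n := by
    intro b
    simp only [hP]
    rw [← Finset.sum_div, ← Nat.cast_sum]
  simp only [e1, e2] at h
  exact h

end Subadditivity

end Literature.Computability.AlgebraicComplexity

end
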